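import Literature.Geometry.Symplectic.SteinSublevelOneOneHandlebody
import Literature.Geometry.Manifold.EmbeddingRangeDiffeomorph
import Literature.Topology.FourManifolds.RegularDomainMaps
import Literature.Topology.FourManifolds.SmoothOrientation
import Literature.Topology.FourManifolds.MorseChartChangeInterior
import Mathlib.Geometry.Manifold.Diffeomorph
import HarnessLib

/-!
# Stub `stub_sublevelTransportSmooth` of line `property-r-mazur-halves` for crux `ConvexBisection.ContractibleTwistedDoubleStandard`
(item stmt-SmoothPoincare4-3546, route route-SmoothPoincare4-ConvexBisection, skeleton m5 "smooth sectors")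

**The sublevel piece of an adapted Morse function below its index-`2` level, transported to an
abstract copy** (the smooth form of the landed `stub_sublevelTransport`, p100017, where the
function was the `J`-convex function of a Stein structure).  Let `W` be a compact orientable
`4`-manifold with boundary, `g : W → ℝ` a Morse function adapted to the boundary (Milnor 1965,
Def. 3.1: Morse, `≡ 1` and regular on `∂W`, `< 1` inside) with exactly one critical point of
index `0` and one of index `1`, and `c < 1` a level through no critical point below which lie
exactly the critical points of index `≤ 1`.  If a compact `4`-manifold with boundary `V` is
smoothly embedded in a `4`-manifold `X` onto `e({g ≤ c})` for a smooth embedding `e : W → X`,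
then `V` is connected and orientable and carries an adapted Morse function with indices `≤ 1`,
one critical point of index `0` and one of index `1` (`stub_sublevelTransportSmooth`, the
registered statement of skeleton m5 of line `property-r-mazur-halves`).

Proof.  (1) `{g ≤ c}` lies in the interior of `W` (`g = 1 > c` on `∂W`), `c` is a regular
level and `g` is nondegenerate at its critical points, so the tree's general sublevel theorem
`Literature.Topology.FourManifolds.sublevel_handlebody_of_counts` (Milnor 1963, Thm. 3.1, 3.2 and
Remark 3.3; `SteinSublevelOneOneHandlebody.lean`) makes `T = ↥(g ⁻¹' Iic c)` (structure
`sublevelAtlas`) a compact connected `4`-manifold with boundary `{g = c}`, orientable since `W`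
is, on which `g|_T + (1 - c)` is an adapted Morse function of profile `(1,1)` with indices `≤ 1`.
(2) `V ≅ T`: the smooth map `jV : V → X` takes values in the image of the embedding `e`, so it
factors as `e ∘ j'` with `j' : V → W` smooth
(`Literature.Geometry.Manifold.exists_contMDiff_comp_eq_of_range_subset`, Lee 2013, Cor. 5.30);
`j'` takes values in `{g ≤ c}`, so it is smooth into `T` (`HalfSliceAtlas.contMDiff_codRestrict`);
conversely `e ∘ Subtype.val : T → X` factors smoothly through the embedding `jV`; the two
factorisations are mutually inverse.  (3) Transport along `Φ : V ≅ T`: connectedness through the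
homeomorphism; orientability by pulling back an orientation (`SmoothOrientation.comapOfDetNeZero`);
the Morse data of `f ∘ Φ` versus `f` by the chain rule and the chart-independence of the Hessian
at an interior critical point (`MorseChartChangeInterior.lean`, Milnor 1963, §2).  Steps (2)–(3)
are the transport lemmas of p100017, copied here (they are private there).

References: J. Milnor, *Morse theory* (1963), §2, Thm. 3.1, Thm. 3.2 and Remark 3.3; J. Milnor,
*Lectures on the h-cobordism theorem* (1965), Lemma 2.9, Def. 3.1; J. M. Lee, *Introduction to
Smooth Manifolds*, 2nd ed. (2013), Cor. 5.30, Thm. 5.31; M. W. Hirsch, *Differential Topology*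
(1976), §4.4.
-/

noncomputable section

-- the prescribed namespace `Summit.<P>.<Sub>.…` duplicates `SmoothPoincare4` (P = Sub)
set_option linter.dupNamespace false

open scoped Manifold ContDiff Topology
open Set Function Literature.Topology.FourManifolds

namespace Summit.SmoothPoincare4.SmoothPoincare4.Theorems.ContractibleTwistedDoubleStandard.PropertyRMazurHalves

/-! ### Morse data transported along a diffeomorphism (adapted from p100017, private there) -/

section Transport

variable {E H : Type*} [NormedAddCommGroup E] [NormedSpace ℝ E] [TopologicalSpace H]
  {I : ModelWithCorners ℝ E H}
  {M : Type*} [TopologicalSpace M] [ChartedSpace H M]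
  {N : Type*} [TopologicalSpace N] [ChartedSpace H N]

/-- **Critical points correspond under a diffeomorphism**: `x` is a critical point of `g ∘ Φ`
iff `Φ x` is a critical point of `g` (chain rule; the differential of a diffeomorphism is a
linear isomorphism). [folklore] -/
private theorem isMCriticalPt_comp_diffeomorph_iff' (Φ : M ≃ₘ⟮I, I⟯ N) {g : N → ℝ} {x : M}
    (hg : MDifferentiableAt I 𝓘(ℝ, ℝ) g (Φ x)) :
    IsMCriticalPt I (g ∘ Φ) x ↔ IsMCriticalPt I g (Φ x) := by
  have hn : (∞ : ℕ∞ω) ≠ 0 := by simp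
  have hΦ : MDifferentiableAt I I Φ x := Φ.mdifferentiable hn x
  unfold IsMCriticalPt
  rw [mfderiv_comp x hg hΦ]
  set L := Φ.mfderivToContinuousLinearEquiv hn x with hL
  have hL' : mfderiv I I Φ x = (L : TangentSpace I x →L[ℝ] TangentSpace I (Φ x)) :=
    (Φ.mfderivToContinuousLinearEquiv_coe hn).symm
  rw [hL']
  show (mfderiv I 𝓘(ℝ, ℝ) g (Φ x)).comp (L : TangentSpace I x →L[ℝ] TangentSpace I (Φ x)) =
      (0 : TangentSpace I x →L[ℝ] TangentSpace 𝓘(ℝ, ℝ) (g (Φ x))) ↔ mfderiv I 𝓘(ℝ, ℝ) g (Φ x) = 0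
  constructor
  · intro h
    have h2 : ((mfderiv I 𝓘(ℝ, ℝ) g (Φ x)).comp (L : TangentSpace I x →L[ℝ] TangentSpace I (Φ x))).comp
        (L.symm : TangentSpace I (Φ x) →L[ℝ] TangentSpace I x) = 0 := by
      rw [h, ContinuousLinearMap.zero_comp]
    rwa [ContinuousLinearMap.comp_assoc, ContinuousLinearEquiv.coe_comp_coe_symm,
      ContinuousLinearMap.comp_id] at h2
  · intro h
    rw [h, ContinuousLinearMap.zero_comp]

/-- The chart `chartAt (Φ x) ∘ Φ` of `M` transported from `N` along a diffeomorphism `Φ`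
belongs to the maximal atlas of `M` (both it and its inverse `Φ⁻¹ ∘ (chartAt (Φ x))⁻¹` are
smooth; Mathlib's `OpenPartialHomeomorph.mem_maximalAtlas_of_contMDiffOn`). [folklore] -/
private theorem transOpenPartialHomeomorph_chartAt_mem_maximalAtlas' [IsManifold I ∞ M] [IsManifold I ∞ N]
    (Φ : M ≃ₘ⟮I, I⟯ N) (x : M) :
    Φ.toHomeomorph.transOpenPartialHomeomorph (chartAt H (Φ x)) ∈ IsManifold.maximalAtlas I ∞ M := by
  apply OpenPartialHomeomorph.mem_maximalAtlas_of_contMDiffOn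
  · simp only [Homeomorph.transOpenPartialHomeomorph_source,
      Homeomorph.transOpenPartialHomeomorph_apply, Diffeomorph.coe_toHomeomorph]
    exact contMDiffOn_chart.comp Φ.contMDiff.contMDiffOn (fun _ h ↦ h)
  · simp only [Homeomorph.transOpenPartialHomeomorph_target,
      Homeomorph.transOpenPartialHomeomorph_symm_apply, Diffeomorph.coe_toHomeomorph_symm]
    exact Φ.symm.contMDiff.comp_contMDiffOn contMDiffOn_chart_symm

/-- In the transported chart `chartAt (Φ x) ∘ Φ`, the Hessian of `g ∘ Φ` at `x` *is* the
Hessian of `g` at `Φ x` in the preferred chart (the two functions written in these charts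
coincide). [cite: Milnor1963, §2] -/
private theorem hessianInChart_transOpenPartialHomeomorph' (Φ : M ≃ₘ⟮I, I⟯ N) (g : N → ℝ) (x : M) :
    hessianInChart I (Φ.toHomeomorph.transOpenPartialHomeomorph (chartAt H (Φ x))) (g ∘ Φ) x =
      mhessian I g (Φ x) := by
  have h1 : (g ∘ Φ) ∘ ((Φ.toHomeomorph.transOpenPartialHomeomorph (chartAt H (Φ x))).extend I).symm =
      writtenInExtChartAt I 𝓘(ℝ, ℝ) (Φ x) g := by
    funext z
    simp [writtenInExtChartAt]
  have h2 : (Φ.toHomeomorph.transOpenPartialHomeomorph (chartAt H (Φ x))).extend I x =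
      extChartAt I (Φ x) (Φ x) := by
    simp
  ext v w
  rw [hessianInChart_apply_apply, h1, h2]
  rfl

/-- **Nondegeneracy and Morse index at an interior critical point are invariant under a
diffeomorphism**: at an interior critical point `x` of `g ∘ Φ`, the Hessian of `g ∘ Φ` is
nondegenerate iff the Hessian of `g` at `Φ x` is, and the Morse indices agree (chart
independence of the Hessian at a critical point, applied to the transported chart). [cite: Milnor1963, §2] -/
private theorem morseData_comp_diffeomorph' [IsManifold I ∞ M] [IsManifold I ∞ N] (Φ : M ≃ₘ⟮I, I⟯ N)
    {g : N → ℝ} (hg : ContMDiff I 𝓘(ℝ, ℝ) ∞ g) {x : M} (hcrit : IsMCriticalPt I (g ∘ Φ) x)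
    (hx : I.IsInteriorPoint x) :
    ((mhessian I (g ∘ Φ) x).Nondegenerate ↔ (mhessian I g (Φ x)).Nondegenerate) ∧
      morseIndex I (g ∘ Φ) x = morseIndex I g (Φ x) := by
  have he : Φ.toHomeomorph.transOpenPartialHomeomorph (chartAt H (Φ x)) ∈
      IsManifold.maximalAtlas I 2 M :=
    IsManifold.maximalAtlas_subset_of_le (I := I) (M := M) (by norm_cast)
      (transOpenPartialHomeomorph_chartAt_mem_maximalAtlas' Φ x)
  have hxe : x ∈ (Φ.toHomeomorph.transOpenPartialHomeomorph (chartAt H (Φ x))).source := by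
    simp
  have hf : ContMDiffAt I 𝓘(ℝ, ℝ) 2 (g ∘ Φ) x :=
    ((hg.comp Φ.contMDiff).of_le (by norm_cast)).contMDiffAt
  refine ⟨?_, ?_⟩
  · rw [nondegenerate_mhessian_iff_of_isInteriorPoint hf hcrit he hxe hx,
      hessianInChart_transOpenPartialHomeomorph']
  · rw [morseIndex_eq_sigNeg_hessianInChart_of_isInteriorPoint hf hcrit he hxe hx,
      hessianInChart_transOpenPartialHomeomorph']
    rfl

/-- Interior points correspond under a diffeomorphism (Mathlib's
`Diffeomorph.preimage_interior`). [folklore] -/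
private theorem isInteriorPoint_iff_comp_diffeomorph' (Φ : M ≃ₘ⟮I, I⟯ N) (x : M) :
    I.IsInteriorPoint x ↔ I.IsInteriorPoint (Φ x) := by
  have h := Φ.preimage_interior (by simp)
  constructor
  · intro hx
    have hx' : x ∈ I.interior M := hx
    rw [← h] at hx'
    exact hx'
  · intro hx
    have hx' : x ∈ Φ ⁻¹' I.interior N := hx
    rw [h] at hx'
    exact hx'

/-- **An adapted Morse function transported along a diffeomorphism is an adapted Morse
function**, with corresponding critical points and the same Morse indices. [cite: Milnor1963, §2] -/
private theorem isMorseAdapted_comp_diffeomorph' [IsManifold I ∞ M] [IsManifold I ∞ N] (Φ : M ≃ₘ⟮I, I⟯ N)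
    {g : N → ℝ} (hg : IsMorseAdapted I g) :
    IsMorseAdapted I (g ∘ Φ) ∧
      ∀ x, IsMCriticalPt I (g ∘ Φ) x →
        IsMCriticalPt I g (Φ x) ∧ morseIndex I (g ∘ Φ) x = morseIndex I g (Φ x) := by
  have hsmooth : ContMDiff I 𝓘(ℝ, ℝ) ∞ g := hg.1.1
  have hdiff : ∀ y, MDifferentiableAt I 𝓘(ℝ, ℝ) g y := fun y =>
    (hsmooth y).mdifferentiableAt (by simp)
  have hcrit : ∀ x, IsMCriticalPt I (g ∘ Φ) x ↔ IsMCriticalPt I g (Φ x) := fun x =>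
    isMCriticalPt_comp_diffeomorph_iff' Φ (hdiff (Φ x))
  -- critical points of `g` are interior points
  have hint : ∀ y, IsMCriticalPt I g y → I.IsInteriorPoint y := by
    intro y hy
    by_contra h
    exact (hg.2.1 y ((I.isBoundaryPoint_iff_not_isInteriorPoint y).2 h)).2 hy
  have hdata : ∀ x, IsMCriticalPt I (g ∘ Φ) x →
      ((mhessian I (g ∘ Φ) x).Nondegenerate ↔ (mhessian I g (Φ x)).Nondegenerate) ∧
        morseIndex I (g ∘ Φ) x = morseIndex I g (Φ x) := fun x hx =>
    morseData_comp_diffeomorph' Φ hsmooth hx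
      ((isInteriorPoint_iff_comp_diffeomorph' Φ x).2 (hint _ ((hcrit x).1 hx)))
  refine ⟨⟨⟨hsmooth.comp Φ.contMDiff, fun x hx => ?_⟩, fun x hx => ?_, fun x hx => ?_⟩,
    fun x hx => ⟨(hcrit x).1 hx, (hdata x hx).2⟩⟩
  · exact (hdata x hx).1.2 (hg.1.2 _ ((hcrit x).1 hx))
  · have hx' : Φ x ∈ I.boundary N := by
      rw [← Φ.preimage_boundary (by simp)] at hx
      exact hx
    exact ⟨(hg.2.1 _ hx').1, fun h => (hg.2.1 _ hx').2 ((hcrit x).1 h)⟩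
  · have hx' : Φ x ∈ I.interior N := by
      rw [← Φ.preimage_interior (by simp)] at hx
      exact hx
    exact hg.2.2 _ hx'

/-- The critical points of index `i` of `g ∘ Φ` are the preimage under the diffeomorphism `Φ`
of those of the adapted Morse function `g`; in particular they are equinumerous. [cite: Milnor1963, §2] -/
private theorem ncard_criticalSetOfIndex_comp_diffeomorph' [IsManifold I ∞ M] [IsManifold I ∞ N]
    (Φ : M ≃ₘ⟮I, I⟯ N) {g : N → ℝ} (hg : IsMorseAdapted I g) (i : ℕ) :
    (criticalSetOfIndex I (g ∘ Φ) i).ncard = (criticalSetOfIndex I g i).ncard := by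
  have hcrit : ∀ x, IsMCriticalPt I (g ∘ Φ) x ↔ IsMCriticalPt I g (Φ x) := fun x =>
    isMCriticalPt_comp_diffeomorph_iff' Φ ((hg.1.1 (Φ x)).mdifferentiableAt (by simp))
  have heq : criticalSetOfIndex I (g ∘ Φ) i = Φ ⁻¹' criticalSetOfIndex I g i := by
    ext x
    simp only [mem_preimage, mem_criticalSetOfIndex]
    constructor
    · rintro ⟨hx, hi⟩
      exact ⟨(hcrit x).1 hx, by rw [← ((isMorseAdapted_comp_diffeomorph' Φ hg).2 x hx).2]; exact hi⟩
    · rintro ⟨hx, hi⟩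
      have hx' := (hcrit x).2 hx
      exact ⟨hx', by rw [((isMorseAdapted_comp_diffeomorph' Φ hg).2 x hx').2]; exact hi⟩
  have hinj : Injective Φ := Φ.toEquiv.injective
  have hsurj : Surjective Φ := Φ.toEquiv.surjective
  rw [heq, Set.ncard_preimage_of_injective_subset_range hinj
    (by rw [hsurj.range_eq]; exact subset_univ _)]

end Transport

/-! ### The abstract copy is diffeomorphic to the sublevel manifold (adapted from p100017) -/

section Diffeo

variable {k : ℕ} {EX HX : Type*} [NormedAddCommGroup EX] [NormedSpace ℝ EX] [TopologicalSpace HX]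
  {J : ModelWithCorners ℝ EX HX} {X : Type*} [TopologicalSpace X] [ChartedSpace HX X]
  {W : Type*} [TopologicalSpace W] [ChartedSpace (EuclideanHalfSpace (k + 1)) W]
  [IsManifold (𝓡∂ (k + 1)) ∞ W]
  {V : Type*} [TopologicalSpace V] [ChartedSpace (EuclideanHalfSpace (k + 1)) V]

/-- **Two realisations of a regular domain are diffeomorphic.**  Let `T ⊆ W` carry a half-slice
atlas (e.g. a regular sublevel set), `e : W → X` and `jV : V → X` smooth embeddings with
`jV(V) = e(T)`.  Then there is a diffeomorphism `Φ : V ≅ T` with `e ∘ Φ = jV`: `jV` factors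
smoothly through the embedding `e` (Lee 2013, Cor. 5.30) with values in `T`, hence smoothly
into `T` (`HalfSliceAtlas.contMDiff_codRestrict`); `e|_T` factors smoothly through `jV`; the
two factorisations are inverse to each other by injectivity. [cite: LeeSmoothManifolds2013, Cor. 5.30 and Thm. 5.31] -/
private theorem exists_diffeomorph_halfSliceAtlas' (hk : 1 ≤ k) {T : Set W}
    (Ψ : HalfSliceAtlas (𝓡∂ (k + 1)) T) {e : W → X}
    (he : Manifold.IsSmoothEmbedding (𝓡∂ (k + 1)) J ∞ e) {jV : V → X}
    (hjV : Manifold.IsSmoothEmbedding (𝓡∂ (k + 1)) J ∞ jV) (hrange : range jV = e '' T) :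
    letI := Ψ.chartedSpace
    ∃ Φ : V ≃ₘ⟮𝓡∂ (k + 1), 𝓡∂ (k + 1)⟯ T, ∀ v, e (Φ v).1 = jV v := by
  letI := Ψ.chartedSpace
  haveI := Ψ.isManifold
  -- `jV = e ∘ j'` with `j' : V → W` smooth, valued in `T`
  obtain ⟨j', hj', hej'⟩ := Literature.Geometry.Manifold.exists_contMDiff_comp_eq_of_range_subset
    he hjV.contMDiff (by rw [hrange]; exact image_subset_range e T)
  have hmem : ∀ v, j' v ∈ T := by
    intro v
    have hv : e (j' v) ∈ e '' T := by
      rw [← hrange, show e (j' v) = jV v from congrFun hej' v]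
      exact mem_range_self v
    obtain ⟨w, hw, hwe⟩ := hv
    rwa [← he.isEmbedding.injective hwe]
  have hto : ContMDiff (𝓡∂ (k + 1)) (𝓡∂ (k + 1)) ∞ (T.codRestrict j' hmem) :=
    Ψ.contMDiff_codRestrict hmem hj'
  -- `e ∘ val = jV ∘ ψ` with `ψ : T → V` smooth
  have hval : ContMDiff (𝓡∂ (k + 1)) (𝓡∂ (k + 1)) ∞ (Subtype.val : T → W) :=
    Ψ.contMDiff_subtype_val hk
  obtain ⟨ψ, hψ, hjψ⟩ := Literature.Geometry.Manifold.exists_contMDiff_comp_eq_of_range_subset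
    hjV (he.contMDiff.comp hval) (by
      rintro _ ⟨y, rfl⟩
      rw [hrange]
      exact ⟨y.1, y.2, rfl⟩)
  have hleft : ∀ v, ψ (T.codRestrict j' hmem v) = v := by
    intro v
    apply hjV.isEmbedding.injective
    rw [show jV (ψ (T.codRestrict j' hmem v)) = e (T.codRestrict j' hmem v).1 from
      congrFun hjψ _]
    exact congrFun hej' v
  have hright : ∀ y, T.codRestrict j' hmem (ψ y) = y := by
    intro y
    apply Subtype.ext
    apply he.isEmbedding.injective
    show e (j' (ψ y)) = e y.1
    rw [show e (j' (ψ y)) = jV (ψ y) from congrFun hej' _]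
    exact congrFun hjψ y
  exact ⟨⟨⟨T.codRestrict j' hmem, ψ, hleft, hright⟩, hto, hψ⟩, fun v => congrFun hej' v⟩

end Diffeo

/-! ### The registered stub -/

/-- **Stub 4 of skeleton m5 (the sublevel piece of an adapted Morse function below its
index-`2` level, transported).**  Let `W` be a compact orientable `4`-manifold with boundary,
`g : W → ℝ` an adapted Morse function (Milnor 1965, Def. 3.1) with exactly one critical point of
index `0` and one of index `1`, and `c < 1` a non-critical level below which lie exactly the
critical points of index `≤ 1`.  If a compact `4`-manifold with boundary `V` is smoothly embedded
in a `4`-manifold `X` onto `e({g ≤ c})` for a smooth embedding `e : W → X`, then `V` is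
connected and orientable and carries an adapted Morse function with indices `≤ 1`, one critical
point of index `0` and one of index `1`.  Proof: `{g ≤ c}` lies in the interior of `W` (`g = 1`
on `∂W`), so the tree's sublevel manifold `↥(g ⁻¹' Iic c)` has all these properties
(`sublevel_handlebody_of_counts`; orientable since `W` is); `V` is diffeomorphic to it
(`exists_diffeomorph_halfSliceAtlas'`), and Morse data, orientability and connectedness
transport along the diffeomorphism.
[cite: Milnor1963, Thm. 3.1, Thm. 3.2 and Remark 3.3] [cite: MilnorHCobordism1965, Lemma 2.9] -/
theorem stub_sublevelTransportSmooth :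
    ∀ (X : Type) [TopologicalSpace X] [T2Space X] [SecondCountableTopology X]
      [ChartedSpace (EuclideanSpace ℝ (Fin 4)) X] [IsManifold (𝓡 4) ∞ X]
      (W : Type) [TopologicalSpace W] [T2Space W] [ChartedSpace (EuclideanHalfSpace 4) W]
      [IsManifold (𝓡∂ 4) ∞ W] [CompactSpace W] (e : W → X),
      Manifold.IsSmoothEmbedding (𝓡∂ 4) (𝓡 4) ∞ e → IsOrientable (𝓡∂ 4) W →
      ∀ (g : W → ℝ), IsMorseAdapted (𝓡∂ 4) g →
      (criticalSetOfIndex (𝓡∂ 4) g 0).ncard = 1 → (criticalSetOfIndex (𝓡∂ 4) g 1).ncard = 1 →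
      ∀ (c : ℝ), c < 1 →
      (∀ z, IsMCriticalPt (𝓡∂ 4) g z → g z ≠ c) →
      (∀ z, IsMCriticalPt (𝓡∂ 4) g z → (g z < c ↔ morseIndex (𝓡∂ 4) g z ≤ 1)) →
      ∀ (V : Type) [TopologicalSpace V] [T2Space V] [SecondCountableTopology V]
        [ChartedSpace (EuclideanHalfSpace 4) V] [IsManifold (𝓡∂ 4) ∞ V] [CompactSpace V] (jV : V → X),
      Manifold.IsSmoothEmbedding (𝓡∂ 4) (𝓡 4) ∞ jV → Set.range jV = e '' (g ⁻¹' Set.Iic c) →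
      ConnectedSpace V ∧ IsOrientable (𝓡∂ 4) V ∧
        ∃ f : V → ℝ, IsMorseAdapted (𝓡∂ 4) f ∧
          (∀ z, IsMCriticalPt (𝓡∂ 4) f z → morseIndex (𝓡∂ 4) f z ≤ 1) ∧
          (criticalSetOfIndex (𝓡∂ 4) f 0).ncard = 1 ∧ (criticalSetOfIndex (𝓡∂ 4) f 1).ncard = 1 := by
  intro X _ _ _ _ _ W _ _ _ _ _ e he hW g hg h0 h1 c hc1 hc' hsep V _ _ _ _ _ _ jV hjV hrange
  -- the hypotheses of `sublevel_handlebody_of_counts`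
  have hint : ∀ p, g p ≤ c → (𝓡∂ (3 + 1)).IsInteriorPoint p := by
    intro p hp
    by_contra hni
    have hb : (𝓡∂ 4).IsBoundaryPoint p := ((𝓡∂ 4).isInteriorPoint_or_isBoundaryPoint p).resolve_left hni
    have h1p : g p = 1 := (hg.2.1 p hb).1
    exact absurd (h1p ▸ hp) (not_le.2 hc1)
  have hreg : ∀ p, g p = c → ¬ IsMCriticalPt (𝓡∂ (3 + 1)) g p := fun p hp hcrit => hc' p hcrit hp
  have hnondeg : ∀ z, g z ≤ c → IsMCriticalPt (𝓡∂ (3 + 1)) g z →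
      (mhessian (𝓡∂ (3 + 1)) g z).Nondegenerate := fun z _ hz => hg.1.2 z hz
  have hle : ∀ z, IsMCriticalPt (𝓡∂ (3 + 1)) g z → g z < c → morseIndex (𝓡∂ (3 + 1)) g z ≤ 1 :=
    fun z hz hzc => (hsep z hz).1 hzc
  have hsub : ∀ i, i ≤ 1 → criticalSetOfIndex (𝓡∂ 4) g i ∩ g ⁻¹' Iio c = criticalSetOfIndex (𝓡∂ 4) g i := by
    intro i hi
    apply inter_eq_left.2
    intro z hz
    exact (hsep z hz.1).2 (hz.2.symm ▸ hi)
  have h0' : (criticalSetOfIndex (𝓡∂ (3 + 1)) g 0 ∩ g ⁻¹' Iio c).ncard = 1 := by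
    rw [hsub 0 zero_le_one]; exact h0
  have h1' : (criticalSetOfIndex (𝓡∂ (3 + 1)) g 1 ∩ g ⁻¹' Iio c).ncard = 1 := by
    rw [hsub 1 le_rfl]; exact h1
  -- the sublevel manifold `T = {g ≤ c}` and its Morse data
  letI := (sublevelAtlas (k := 3) hg.1.1 c hint hreg).chartedSpace
  haveI := (sublevelAtlas (k := 3) hg.1.1 c hint hreg).isManifold
  obtain ⟨_, hconn, hor, -, -, hF, hidx, hc0, hc1'⟩ :=
    sublevel_handlebody_of_counts (k := 3) (by norm_num) hg.1.1 hint hreg hnondeg hle h0' h1'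
  -- the diffeomorphism `Φ : V ≅ T`
  obtain ⟨Φ, -⟩ := exists_diffeomorph_halfSliceAtlas' (k := 3) (by norm_num)
    (sublevelAtlas (k := 3) hg.1.1 c hint hreg) he hjV hrange
  set f : ↥(g ⁻¹' Iic c) → ℝ := fun x => g x + (1 - c) with hf
  obtain ⟨hFΦ, hcritΦ⟩ := isMorseAdapted_comp_diffeomorph' Φ hF
  refine ⟨?_, ?_, f ∘ Φ, hFΦ, fun z hz => ?_, ?_, ?_⟩
  · -- connectedness through the homeomorphism `Φ⁻¹`
    rw [connectedSpace_iff_univ, ← Φ.symm.surjective.range_eq]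
    exact isConnected_range Φ.symm.continuous
  · -- orientability: pull an orientation of `T` back along `Φ`
    obtain ⟨oT⟩ := hor hW
    refine ⟨oT.comapOfDetNeZero Φ Φ.contMDiff (by simp) fun x => ?_⟩
    exact (Φ.mfderivToContinuousLinearEquiv (by simp) x).toLinearEquiv.isUnit_det'.ne_zero
  · rw [(hcritΦ z hz).2]
    exact hidx _ (hcritΦ z hz).1
  · rw [ncard_criticalSetOfIndex_comp_diffeomorph' Φ hF 0]; exact hc0
  · rw [ncard_criticalSetOfIndex_comp_diffeomorph' Φ hF 1]; exact hc1'

end Summit.SmoothPoincare4.SmoothPoincare4.Theorems.ContractibleTwistedDoubleStandard.PropertyRMazurHalves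

end
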